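import Literature.NumberTheory.Automorphic.UnitaryGroupDiagTraceExplicitWeights
import Literature.NumberTheory.Automorphic.UnitaryGroupTorusMeasureCoherence
import HarnessLib

/-!
# The covolume weights of an admissible family are STABLE-CLASS INVARIANT once its torus measures are coherent
# (reader (O10-c3): `a_{[γ]} = a_{[γ′]}` for stably conjugate regular `γ, γ′ ∈ U(H)(L⁺)`), with the lattice-side facts
# that make ★ (b2) callable by name
(Rogawski, *Automorphic representations of unitary groups in three variables* (1990), §14.5 pp. 237–238: `a_γ = ε_st(γ₀)⁻¹ · m(Z𝐆_γ \ 𝐆_γ(𝔸))`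
depends only on the stable class; §4.3 pp. 43–44: compatible measures on stably conjugate tori; Gelbart (1975), Remark 9.23)

Topic `NumberTheory/Automorphic`; namespace `Literature.NumberTheory.Automorphic.UnitaryGroup`.  THEOREMS ONLY (no definition, no instance, no named fact,
no `sorry`); imports ★ `UnitaryGroupDiagTraceExplicitWeights` ((O10-c1): the (O-H) weights of an admissible family `m` are the covolumes
`vol(U(H)(L⁺)_γ \ U(H)(𝔸)_γ ; νZ_m [γ])` of the UNIQUE Haar measures `νZ_m [γ]` with `m [γ] = dν ∕ d νZ_m[γ]`, ★ `haarFamily_unique`) and ★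
`UnitaryGroupTorusMeasureCoherence` ((b2) `covolume_eq_of_map_adelicStableCentralizerEquiv_eq`: equal covolumes for torus measures carried onto each other
by the stable-centraliser isomorphism `e_𝔸 = adelicStableCentralizerEquiv`, and (δ4-CM) which PRODUCES that coherence for the restricted-product torus towers).

§0 LATTICE-SIDE FACTS for any `γ ∈ U(H)(𝔸)` (the discharges of the standing hypothesis families of ★ `UnitaryGroupOrbitalDescent` §3 ∕ ★
`UnitaryGroupDiagTraceExplicitWeights` §3 — `[∀ γ, IsClosed Z(γ)]`, `[∀ γ, IsHaarMeasure (count on U(H)(L⁺)_γ)]`): the centraliser `Z(γ) = U(H)(𝔸)_γ` is closed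
(Hausdorff group); the lattice `U(H)(L⁺)_γ = U(H)(L⁺) ∩ Z(γ) ≤ Z(γ)` is countable and DISCRETE (`U(H)(L⁺)` is, ★ `discreteTopology_cmDatum_quotientSubgroup`),
so the counting measure on it is a Haar measure (★ `isHaarMeasure_count_of_discrete`).
§1 (b2)′ `covolume_eq_of_map_adelicStableCentralizerEquiv_eq'`: ★ (b2) in the same-form case `H′ = H`, restated in the CURRENCY OF THOSE FAMILIES — its
twelve anonymous lattice-side instance binders (`MeasurableSingletonClass`, the `count` invariance ∕ finiteness ∕ `SFinite` facts) are discharged inside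
(★ `countable_cmDatum_quotientSubgroup`, Borel ∕ T₂) or read off the goal, so that (b2) is callable from any downstream file BY NAME.
§2 THE READER: if the family member `m [γ]` (resp. `m [γ′]`) is ALSO exhibited as a quotient measure `dν ∕ dt` (resp. `dν ∕ dt′`) for Haar measures
`t, t′` with `(e_𝔸)_* t = t′` — which is what the tower step (O10-c2b)∕(O10-c4) ∘ ★ (δ4-CM) delivers for `m = AdelicOrbitalMeasureFamily.ofLocal` of canonical
local families — then the (O10-c1) weights agree: `a_{[γ]} = a_{[γ′]}`.  Proof: `νZ [γ] = t`, `νZ [γ′] = t′` by uniqueness, then (b2)′.  This is the input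
of the ED 1.21∕1.22 pin (viii⁵) «`β` is constant on the rational classes of a regular stable class» for the anchored kit of the ENGINE T1 line
`F0_T1InnerFormTraceIdentity` (F0P3a RULING #100 (b), #102 (7), #104 (3)).

* `UnitaryGroup.isClosed_centralizer_cmDatum`, `…countable_quotientSubgroup_inf_centralizer_subgroupOf`,
  `…discreteTopology_quotientSubgroup_inf_centralizer_subgroupOf`, `…isHaarMeasure_count_quotientSubgroup_inf_centralizer_subgroupOf` (§0);
* `UnitaryGroup.covolume_eq_of_map_adelicStableCentralizerEquiv_eq'` (§1);
* `UnitaryGroup.covol_eq_of_eq_quotientMeasure_of_map_eq` — §2 for two rational classes `c, c′` with `out c ↔ out c′` stably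
  conjugate (`Corresponds (cmConjRingHom L) H H (out c) (out c′)`) and `out c` regular;
* `UnitaryGroup.covolWeight_eq_of_eq_quotientMeasure_of_map_eq` — the same in the `ℝ`-valued weight currency `a c = (covol …).toReal` of ★
  `exists_covolWeight_diagTrace_eq_finsum_orbitalSum`.

## References
* J. D. Rogawski, *Automorphic Representations of Unitary Groups in Three Variables*, Ann. of Math. Stud. 123 (1990), §4.3 pp. 43–44; §14.5 pp. 237–238 [Rogawski1990].
* S. Gelbart, *Automorphic forms on adele groups* (1975), Remark 9.23 [Gelbart1975].
* A. Deitmar, S. Echterhoff, *Principles of Harmonic Analysis*, 2nd ed. (2014), Thm. 1.5.3 [DeitmarEchterhoff2014].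
-/

set_option autoImplicit false

noncomputable section

open _root_.MeasureTheory _root_.MeasureTheory.Measure Set Filter Function NumberField
open _root_.Topology
open Literature.MeasureTheory.Group Literature.NumberTheory.Rogawski1990
open scoped ENNReal NNReal

namespace Literature.NumberTheory.Automorphic

namespace UnitaryGroup

variable (L : Type) [Field L] [NumberField L] [IsCMField L] (N : ℕ) (H : Matrix (Fin N) (Fin N) L)

/-! ### §0 Lattice-side facts: `Z(γ)` closed, `U(H)(L⁺)_γ` countable and discrete, `count` on it a Haar measure -/

/-- The lattice `U(H)(L⁺)_γ = U(H)(L⁺) ∩ U(H)(𝔸)_γ` (as a subgroup of the adelic centraliser) is countable (`U(H)(L⁺)` is: ★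
`countable_cmDatum_quotientSubgroup`). [cite: Rogawski1990, §14.5 p. 238] -/
theorem countable_quotientSubgroup_inf_centralizer_subgroupOf (γ : (cmDatum L N H).Adelic) :
    Countable ↥(((cmDatum L N H).quotientSubgroup ⊓ Subgroup.centralizer ({γ} : Set (cmDatum L N H).Adelic)).subgroupOf
      (Subgroup.centralizer ({γ} : Set (cmDatum L N H).Adelic))) := by
  haveI := countable_cmDatum_quotientSubgroup L N H
  haveI : Countable ↥((cmDatum L N H).quotientSubgroup ⊓ Subgroup.centralizer ({γ} : Set (cmDatum L N H).Adelic)) :=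
    (Subgroup.inclusion_injective (inf_le_left : (cmDatum L N H).quotientSubgroup ⊓
      Subgroup.centralizer ({γ} : Set (cmDatum L N H).Adelic) ≤ _)).countable
  exact (Subgroup.subgroupOfEquivOfLe (inf_le_right : (cmDatum L N H).quotientSubgroup ⊓
      Subgroup.centralizer ({γ} : Set (cmDatum L N H).Adelic) ≤ _)).injective.countable

/-- The adelic centraliser `Z(γ) = U(H)(𝔸)_γ` is CLOSED (`U(H)(𝔸)` is a Hausdorff topological group: `Z(γ) = {k | kγ = γk}`) — the
discharge of the standing family `[∀ γ, IsClosed Z(γ)]`. [cite: Rogawski1990, §14.5 p. 238] -/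
theorem isClosed_centralizer_cmDatum (γ : (cmDatum L N H).Adelic) :
    IsClosed ((Subgroup.centralizer ({γ} : Set (cmDatum L N H).Adelic) : Subgroup (cmDatum L N H).Adelic) :
      Set (cmDatum L N H).Adelic) := by
  have hset : ((Subgroup.centralizer ({γ} : Set (cmDatum L N H).Adelic) : Subgroup (cmDatum L N H).Adelic) :
      Set (cmDatum L N H).Adelic) = {k | k * γ = γ * k} := by
    ext k
    rw [SetLike.mem_coe, Set.mem_setOf_eq]
    exact Subgroup.mem_centralizer_singleton_iff
  rw [hset]
  exact isClosed_eq (continuous_id.mul continuous_const) (continuous_const.mul continuous_id)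

/-- The lattice `U(H)(L⁺)_γ ≤ Z(γ)` is DISCRETE: it injects continuously into the discrete `U(H)(L⁺) ≤ U(H)(𝔸)` (★
`discreteTopology_cmDatum_quotientSubgroup`). [cite: Rogawski1990, §14.5 p. 238] -/
theorem discreteTopology_quotientSubgroup_inf_centralizer_subgroupOf (γ : (cmDatum L N H).Adelic) :
    DiscreteTopology ↥(((cmDatum L N H).quotientSubgroup ⊓ Subgroup.centralizer ({γ} : Set (cmDatum L N H).Adelic)).subgroupOf
      (Subgroup.centralizer ({γ} : Set (cmDatum L N H).Adelic))) := by
  haveI : DiscreteTopology (cmDatum L N H).quotientSubgroup := discreteTopology_cmDatum_quotientSubgroup L N H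
  have hmem : ∀ x : ↥(Subgroup.centralizer ({γ} : Set (cmDatum L N H).Adelic)),
      x ∈ ((cmDatum L N H).quotientSubgroup ⊓ Subgroup.centralizer ({γ} : Set (cmDatum L N H).Adelic)).subgroupOf
        (Subgroup.centralizer ({γ} : Set (cmDatum L N H).Adelic)) → (x : (cmDatum L N H).Adelic) ∈ (cmDatum L N H).quotientSubgroup :=
    fun x hx => (Subgroup.mem_inf.1 (Subgroup.mem_subgroupOf.1 hx)).1
  refine DiscreteTopology.of_continuous_injective
    (f := fun x => (⟨((x : ↥(Subgroup.centralizer ({γ} : Set (cmDatum L N H).Adelic))) : (cmDatum L N H).Adelic), hmem x x.2⟩ :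
      (cmDatum L N H).quotientSubgroup)) ?_ ?_
  · exact (continuous_subtype_val.comp continuous_subtype_val).subtype_mk _
  · intro a b hab
    exact Subtype.ext (Subtype.ext (congrArg (fun y : (cmDatum L N H).quotientSubgroup => (y : (cmDatum L N H).Adelic)) hab))

/-- The COUNTING MEASURE on the lattice `U(H)(L⁺)_γ` is a Haar measure (discrete countable group: ★ `isHaarMeasure_count_of_discrete`) — the
discharge of the standing family `[∀ γ, IsHaarMeasure (count : Measure U(H)(L⁺)_γ)]` (the lattice currency of ★
`integral_quotientKernel_diag_eq_mul_tsum_covol_cmDatum`). [cite: Rogawski1990, §14.5 p. 238] [cite: Gelbart1975, Remark 9.23] -/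
theorem isHaarMeasure_count_quotientSubgroup_inf_centralizer_subgroupOf [MeasurableSpace (cmDatum L N H).Adelic]
    [BorelSpace (cmDatum L N H).Adelic] (γ : (cmDatum L N H).Adelic) :
    (count : Measure ↥(((cmDatum L N H).quotientSubgroup ⊓ Subgroup.centralizer ({γ} : Set (cmDatum L N H).Adelic)).subgroupOf
      (Subgroup.centralizer ({γ} : Set (cmDatum L N H).Adelic)))).IsHaarMeasure := by
  haveI := discreteTopology_quotientSubgroup_inf_centralizer_subgroupOf L N H γ
  haveI := countable_quotientSubgroup_inf_centralizer_subgroupOf L N H γ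
  haveI : MeasurableSingletonClass (cmDatum L N H).Adelic := inferInstance
  exact isHaarMeasure_count_of_discrete

variable
  [MeasurableSpace (cmDatum L N H).Adelic] [BorelSpace (cmDatum L N H).Adelic]
  [∀ γ : (cmDatum L N H).Adelic,
    MeasurableSpace ((cmDatum L N H).Adelic ⧸ Subgroup.centralizer ({γ} : Set (cmDatum L N H).Adelic))]
  [∀ γ : (cmDatum L N H).Adelic,
    BorelSpace ((cmDatum L N H).Adelic ⧸ Subgroup.centralizer ({γ} : Set (cmDatum L N H).Adelic))]
  [∀ γ : (cmDatum L N H).Adelic, MeasurableSpace (↥(Subgroup.centralizer ({γ} : Set (cmDatum L N H).Adelic)) ⧸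
    ((cmDatum L N H).quotientSubgroup ⊓ Subgroup.centralizer ({γ} : Set (cmDatum L N H).Adelic)).subgroupOf
      (Subgroup.centralizer ({γ} : Set (cmDatum L N H).Adelic)))]
  [∀ γ : (cmDatum L N H).Adelic, BorelSpace (↥(Subgroup.centralizer ({γ} : Set (cmDatum L N H).Adelic)) ⧸
    ((cmDatum L N H).quotientSubgroup ⊓ Subgroup.centralizer ({γ} : Set (cmDatum L N H).Adelic)).subgroupOf
      (Subgroup.centralizer ({γ} : Set (cmDatum L N H).Adelic)))]
  [hCcl : ∀ γ : (cmDatum L N H).Adelic, IsClosed ((Subgroup.centralizer ({γ} : Set (cmDatum L N H).Adelic) :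
    Subgroup (cmDatum L N H).Adelic) : Set (cmDatum L N H).Adelic)]
  [∀ γ : (cmDatum L N H).Adelic, (count : Measure ↥(((cmDatum L N H).quotientSubgroup ⊓
    Subgroup.centralizer ({γ} : Set (cmDatum L N H).Adelic)).subgroupOf
      (Subgroup.centralizer ({γ} : Set (cmDatum L N H).Adelic)))).IsHaarMeasure]

/-! ### §1 ★ (b2) in the currency of the standing families (callable cross-file by name) -/

omit [∀ γ : (cmDatum L N H).Adelic,
    MeasurableSpace ((cmDatum L N H).Adelic ⧸ Subgroup.centralizer ({γ} : Set (cmDatum L N H).Adelic))]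
  [∀ γ : (cmDatum L N H).Adelic,
    BorelSpace ((cmDatum L N H).Adelic ⧸ Subgroup.centralizer ({γ} : Set (cmDatum L N H).Adelic))] in
/-- **(b2)′ Stably conjugate regular `γ ↔ γ′ ∈ U(H)(L⁺)` have the same weight `m(Z_γ(L⁺) \ Z_γ(𝔸))` once their torus measures are coherent** —
★ (b2) `covolume_eq_of_map_adelicStableCentralizerEquiv_eq` in the same-form case `H′ = H`, with its anonymous lattice-side instance binders
(`MeasurableSingletonClass`, `SFinite (count …)` — from ★ `countable_cmDatum_quotientSubgroup` and Borel ∕ T₂ — and the `count`-invariance ∕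
finiteness facts and the closedness of the lattices — read off this statement) DISCHARGED: the only standing hypotheses are the families
`[∀ γ, IsClosed Z(γ)]`, `[∀ γ, IsHaarMeasure (count on U(H)(L⁺)_γ)]` and the Borel structures on the quotients, i.e. the currency of ★
`UnitaryGroupDiagTraceExplicitWeights` §3.  (The proof feeds ★ (b2) its instance binders by unification, `(_)`, not by instance search.)
`γ, γ′` are EXPLICIT and should be passed in the spelling `(… : (cmDatum L N H).Rational)`: a `γ` inferred from `hc` alone is elaborated against
`↥(unitaryGroup (cmConjRingHom L) H)` (the binder type of ★ `Corresponds`), which differs from the `cmDatum` spelling of the torus ∕ lattice carriers by a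
`δ`-step (`cmDatum` is not reducible) — invisible to the pretty-printer, harmless to `exact`, but fatal to instance resolution on those carriers.
-- TODO(general form): two hermitian forms `H, H′` (★ (b2) itself); the same-form case is what the stable-class bookkeeping (O10-c3)∕(c4) uses.
[cite: Rogawski1990, §14.5 pp. 237–238] [cite: Rogawski1990, §4.3 pp. 43–44] [cite: Gelbart1975, Remark 9.23] -/
theorem covolume_eq_of_map_adelicStableCentralizerEquiv_eq' (hH : H.det ≠ 0) (γ γ' : (cmDatum L N H).Rational)
    (hc : Corresponds (cmConjRingHom L) H H γ γ') (hreg : IsRegularElt (γ.val : GL (Fin N) L))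
    (tA : Measure ↥(Subgroup.centralizer ({(cmDatum L N H).toAdelic γ} : Set (cmDatum L N H).Adelic)))
    [IsHaarMeasure tA] [tA.IsMulRightInvariant]
    (tA' : Measure ↥(Subgroup.centralizer ({(cmDatum L N H).toAdelic γ'} : Set (cmDatum L N H).Adelic)))
    [IsHaarMeasure tA'] [tA'.IsMulRightInvariant]
    (h : Measure.map (adelicStableCentralizerEquiv L hH hH hc hreg) tA = tA') :
    quotientMeasure (((cmDatum L N H).quotientSubgroup ⊓
        Subgroup.centralizer ({(cmDatum L N H).toAdelic γ} : Set (cmDatum L N H).Adelic)).subgroupOf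
        (Subgroup.centralizer ({(cmDatum L N H).toAdelic γ} : Set (cmDatum L N H).Adelic))) count
        (isClosed_subgroupOf _ _ ((isClosed_cmDatum_quotientSubgroup L N H).inter (hCcl _))) tA Set.univ =
      quotientMeasure (((cmDatum L N H).quotientSubgroup ⊓
        Subgroup.centralizer ({(cmDatum L N H).toAdelic γ'} : Set (cmDatum L N H).Adelic)).subgroupOf
        (Subgroup.centralizer ({(cmDatum L N H).toAdelic γ'} : Set (cmDatum L N H).Adelic))) count
        (isClosed_subgroupOf _ _ ((isClosed_cmDatum_quotientSubgroup L N H).inter (hCcl _))) tA' Set.univ := by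
  -- the lattice `U(H)(L⁺) ∩ Z(γ)` is countable, hence `count` on it is s-finite; singletons are measurable (Borel, T₂)
  haveI iC := countable_quotientSubgroup_inf_centralizer_subgroupOf L N H ((cmDatum L N H).toAdelic γ)
  haveI iC' := countable_quotientSubgroup_inf_centralizer_subgroupOf L N H ((cmDatum L N H).toAdelic γ')
  haveI : MeasurableSingletonClass (cmDatum L N H).Adelic := inferInstance
  haveI iMS : MeasurableSingletonClass ↥(((cmDatum L N H).quotientSubgroup ⊓
      Subgroup.centralizer ({(cmDatum L N H).toAdelic γ} : Set (cmDatum L N H).Adelic)).subgroupOf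
      (Subgroup.centralizer ({(cmDatum L N H).toAdelic γ} : Set (cmDatum L N H).Adelic))) := inferInstance
  haveI iMS' : MeasurableSingletonClass ↥(((cmDatum L N H).quotientSubgroup ⊓
      Subgroup.centralizer ({(cmDatum L N H).toAdelic γ'} : Set (cmDatum L N H).Adelic)).subgroupOf
      (Subgroup.centralizer ({(cmDatum L N H).toAdelic γ'} : Set (cmDatum L N H).Adelic))) := inferInstance
  haveI iSF : SFinite (count : Measure ↥(((cmDatum L N H).quotientSubgroup ⊓
      Subgroup.centralizer ({(cmDatum L N H).toAdelic γ} : Set (cmDatum L N H).Adelic)).subgroupOf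
      (Subgroup.centralizer ({(cmDatum L N H).toAdelic γ} : Set (cmDatum L N H).Adelic)))) := inferInstance
  haveI iSF' : SFinite (count : Measure ↥(((cmDatum L N H).quotientSubgroup ⊓
      Subgroup.centralizer ({(cmDatum L N H).toAdelic γ'} : Set (cmDatum L N H).Adelic)).subgroupOf
      (Subgroup.centralizer ({(cmDatum L N H).toAdelic γ'} : Set (cmDatum L N H).Adelic)))) := inferInstance
  -- ★ (b2) with its instance binders filled by UNIFICATION against this goal (`(_)`) or by the named instances above — not by instance
  -- search on (b2)'s binder spellings (which does not re-derive the lattice-side facts in a downstream file)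
  exact @covolume_eq_of_map_adelicStableCentralizerEquiv_eq L _ _ _ N H H γ γ'
    (_) ‹BorelSpace (cmDatum L N H).Adelic› (_) ‹BorelSpace (cmDatum L N H).Adelic› hH hH hc hreg (hCcl _) (hCcl _) (_) (_)
    (_) (_) (_) (_) iMS iMS' (_) (_) (_) (_) iSF (_) (_) (_) (_) iSF'
    tA ‹IsHaarMeasure tA› (_) tA' ‹IsHaarMeasure tA'› (_) h

/-! ### §2 The reader (O10-c3) -/

variable
  (ν : Measure (cmDatum L N H).Adelic) [ν.IsHaarMeasure] [ν.IsMulRightInvariant]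
  (νZ : ∀ c : ConjClasses (cmDatum L N H).Rational,
    Measure ↥(Subgroup.centralizer ({(cmDatum L N H).toAdelic (Quotient.out c)} : Set (cmDatum L N H).Adelic)))
  [∀ c, IsHaarMeasure (νZ c)] [∀ c, (νZ c).IsMulRightInvariant] [∀ c, (νZ c).IsInvInvariant]

/-- **The covolume weights of a family are stable-class invariant once its torus measures are coherent** (reader (O10-c3)).  Let `m` be a family
of adelic orbital measures of the anisotropic `U(H)` read as quotient measures `m [γ] = dν ∕ d(νZ [γ])` (★ (O10-c1) `exists_haarFamily_eq_quotientMeasure`);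
let `c, c′` be rational classes whose representatives `out c ↔ out c′` are stably conjugate with `out c` regular; and suppose `m c = dν ∕ dt`,
`m c′ = dν ∕ dt′` for Haar measures `t, t′` carried onto each other by the stable-centraliser isomorphism, `(e_𝔸)_* t = t′` (what the restricted-product
tower (O10-c2b) ∘ ★ (δ4-CM) `map_adelicStableCentralizerEquiv_torusMeasure_eq` provide for `m = ofLocal` of canonical local families).  Then the
covolumes `vol(U(H)(L⁺)_{γ_c} \ U(H)(𝔸)_{γ_c} ; νZ c) = vol(U(H)(L⁺)_{γ_{c′}} \ U(H)(𝔸)_{γ_{c′}} ; νZ c′)` — `νZ c = t`, `νZ c′ = t′` by ★ `haarFamily_unique`, then ★ (b2)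
`covolume_eq_of_map_adelicStableCentralizerEquiv_eq` (§1's primed form). [cite: Rogawski1990, §14.5 pp. 237–238] [cite: Rogawski1990, §4.3 pp. 43–44] -/
theorem covol_eq_of_eq_quotientMeasure_of_map_eq (hH : H.det ≠ 0)
    (m : AdelicOrbitalMeasureFamily L N H)
    (hm : ∀ c, m c = quotientMeasure (Subgroup.centralizer ({(cmDatum L N H).toAdelic (Quotient.out c)} : Set (cmDatum L N H).Adelic))
      (νZ c) (hCcl _) ν)
    (c c' : ConjClasses (cmDatum L N H).Rational)
    (hc : Corresponds (cmConjRingHom L) H H (Quotient.out c : (cmDatum L N H).Rational) (Quotient.out c' : (cmDatum L N H).Rational))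
    (hreg : IsRegularElt ((Quotient.out c).val : GL (Fin N) L))
    (t : Measure ↥(Subgroup.centralizer ({(cmDatum L N H).toAdelic (Quotient.out c)} : Set (cmDatum L N H).Adelic)))
    [IsHaarMeasure t] [t.IsMulRightInvariant] [t.IsInvInvariant]
    (t' : Measure ↥(Subgroup.centralizer ({(cmDatum L N H).toAdelic (Quotient.out c')} : Set (cmDatum L N H).Adelic)))
    [IsHaarMeasure t'] [t'.IsMulRightInvariant] [t'.IsInvInvariant]
    (ht : m c = quotientMeasure (Subgroup.centralizer ({(cmDatum L N H).toAdelic (Quotient.out c)} : Set (cmDatum L N H).Adelic)) t (hCcl _) ν)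
    (ht' : m c' = quotientMeasure (Subgroup.centralizer ({(cmDatum L N H).toAdelic (Quotient.out c')} : Set (cmDatum L N H).Adelic)) t' (hCcl _) ν)
    (hmap : Measure.map (adelicStableCentralizerEquiv L hH hH hc hreg) t = t') :
    quotientMeasure (((cmDatum L N H).quotientSubgroup ⊓
        Subgroup.centralizer ({(cmDatum L N H).toAdelic (Quotient.out c)} : Set (cmDatum L N H).Adelic)).subgroupOf
        (Subgroup.centralizer ({(cmDatum L N H).toAdelic (Quotient.out c)} : Set (cmDatum L N H).Adelic))) count
        (isClosed_subgroupOf _ _ ((isClosed_cmDatum_quotientSubgroup L N H).inter (hCcl _))) (νZ c) Set.univ =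
      quotientMeasure (((cmDatum L N H).quotientSubgroup ⊓
        Subgroup.centralizer ({(cmDatum L N H).toAdelic (Quotient.out c')} : Set (cmDatum L N H).Adelic)).subgroupOf
        (Subgroup.centralizer ({(cmDatum L N H).toAdelic (Quotient.out c')} : Set (cmDatum L N H).Adelic))) count
        (isClosed_subgroupOf _ _ ((isClosed_cmDatum_quotientSubgroup L N H).inter (hCcl _))) (νZ c') Set.univ := by
  -- uniqueness of the reproducing torus measures: `νZ c = t`, `νZ c′ = t′`
  have h1 : νZ c = t := haarFamily_unique L N H ν c (νZ c) t ((hm c).symm.trans ht)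
  have h2 : νZ c' = t' := haarFamily_unique L N H ν c' (νZ c') t' ((hm c').symm.trans ht')
  subst h1 h2
  exact covolume_eq_of_map_adelicStableCentralizerEquiv_eq' L N H hH (Quotient.out c) (Quotient.out c') hc hreg (νZ c) (νZ c') hmap

/-- **The same in the `ℝ`-valued weight currency** of ★ `exists_covolWeight_diagTrace_eq_finsum_orbitalSum`: with `a c := (vol(… ; νZ c)).toReal`,
`a c = a c′` for stably conjugate regular representatives — the reading the ED 1.21 pin (viii⁵) consumes («`β` is constant on the rational classes of a
regular stable class», cf. ★ `StableClass.ofConjClass_eq_ofConjClass_iff_isStablyConj_out`). [cite: Rogawski1990, §14.5 pp. 237–238] -/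
theorem covolWeight_eq_of_eq_quotientMeasure_of_map_eq (hH : H.det ≠ 0)
    (m : AdelicOrbitalMeasureFamily L N H)
    (hm : ∀ c, m c = quotientMeasure (Subgroup.centralizer ({(cmDatum L N H).toAdelic (Quotient.out c)} : Set (cmDatum L N H).Adelic))
      (νZ c) (hCcl _) ν)
    (a : ConjClasses (cmDatum L N H).Rational → ℝ)
    (ha : ∀ c, a c = (quotientMeasure (((cmDatum L N H).quotientSubgroup ⊓
        Subgroup.centralizer ({(cmDatum L N H).toAdelic (Quotient.out c)} : Set (cmDatum L N H).Adelic)).subgroupOf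
        (Subgroup.centralizer ({(cmDatum L N H).toAdelic (Quotient.out c)} : Set (cmDatum L N H).Adelic))) count
        (isClosed_subgroupOf _ _ ((isClosed_cmDatum_quotientSubgroup L N H).inter (hCcl _))) (νZ c) Set.univ).toReal)
    (c c' : ConjClasses (cmDatum L N H).Rational)
    (hc : Corresponds (cmConjRingHom L) H H (Quotient.out c : (cmDatum L N H).Rational) (Quotient.out c' : (cmDatum L N H).Rational))
    (hreg : IsRegularElt ((Quotient.out c).val : GL (Fin N) L))
    (t : Measure ↥(Subgroup.centralizer ({(cmDatum L N H).toAdelic (Quotient.out c)} : Set (cmDatum L N H).Adelic)))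
    [IsHaarMeasure t] [t.IsMulRightInvariant] [t.IsInvInvariant]
    (t' : Measure ↥(Subgroup.centralizer ({(cmDatum L N H).toAdelic (Quotient.out c')} : Set (cmDatum L N H).Adelic)))
    [IsHaarMeasure t'] [t'.IsMulRightInvariant] [t'.IsInvInvariant]
    (ht : m c = quotientMeasure (Subgroup.centralizer ({(cmDatum L N H).toAdelic (Quotient.out c)} : Set (cmDatum L N H).Adelic)) t (hCcl _) ν)
    (ht' : m c' = quotientMeasure (Subgroup.centralizer ({(cmDatum L N H).toAdelic (Quotient.out c')} : Set (cmDatum L N H).Adelic)) t' (hCcl _) ν)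
    (hmap : Measure.map (adelicStableCentralizerEquiv L hH hH hc hreg) t = t') :
    a c = a c' := by
  rw [ha c, ha c', covol_eq_of_eq_quotientMeasure_of_map_eq L N H ν νZ hH m hm c c' hc hreg t t' ht ht' hmap]

end UnitaryGroup

end Literature.NumberTheory.Automorphic
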